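import Literature.NumberTheory.Automorphic.UnitaryGroupArchIntegratedOperatorNuclearOfKTypeGrowth
import Literature.NumberTheory.Automorphic.UnitaryRepKCasimirBlockBound
import Literature.NumberTheory.Automorphic.UnitaryRepFiniteBlocksSmooth
import Literature.NumberTheory.Automorphic.HilbertRepIrreducibleBlockSubmodules
import Literature.NumberTheory.Automorphic.CompactGroupBlockNuclearTraceClass
import Literature.NumberTheory.Automorphic.HarishChandraSpaceDenseProofs
import HarnessLib

/-!
# The letter V22 (nuclearity of `(ϖ ∘ proj)(φ)` under `K`-type growth, Varadarajan Thm. 22) ASSEMBLED from its two payable pieces: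
# the Casimir operator family (H3b) and the block Casimir-weight summability (H4 = Lemma 21 in block form)

Topic `NumberTheory/Automorphic`; namespace `Literature.NumberTheory.Automorphic.UnitaryGroup` (home of the letters A5 ★ `ArchIntegratedOperatorTraceClass` and V22 ★
`ArchIntegratedOperatorNuclearOfKTypeGrowth`).  Theorems only (no definition, no named fact, no instance, no `sorry`).  Cell `hodgecm-mathlib`, line T1a, road HC,
the LEAD's ASSEMBLY CONTRACT (F0P3b-p01 (g2), bus 2026-08-31T17:3xZ) made kernel-checked: the two remaining payable statements appear here as HYPOTHESES, token for
token in the currency of the landed in-house nodes, and the letter V22 follows from them — so that their payers (A-p14: H3b; A-p03 ∕ A-p06 ∕ lead: H4b ∕ hq ∕ G1) prove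
exactly what is consumed.

THE PIECES.
* `hfam` (H3b, [Varadarajan1989 §5.4 proof of Thm. 22: `∫ f_{jk}(x;E^r) f = ∫ f_{jk} f(x;E'^r)`], [Knapp1986 (10.4)–(10.6)]): for each `n` an operator family `T : ℕ → (E →L E)`
  with `T 0 = Op_φ` and `T j (v + Ω_K v) = T (j+1) v` on `H_K^∞` (`Ω_K` = ★ `upqKCasimirVec`, A-p14 p829889) — in print `T j = Op_{(1+Ω_K)^j φ}` by integration by parts.
* `hsum` (H4 = Lemma 21 in block form + the growth hypothesis): for every pairwise orthogonal set `S` of irreducible finite-dimensional SMOOTH closed `K`-blocks of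
  `ϖ|_K` there is `n` with `Σ_{W ∈ S} dim W · (1 + q_W)^{-n} < ∞` (`q_W` = ★ `upqKBlockScalar`), from the label `(a, n₁, n₂)` of the blocks (H4b, A-p03), `1 + q_W ≥
  δ(1 + a² + n₁² + n₂²)` (hq, A-p06), the lattice sum ★ p829656 (A-p06) and the fibre count ★ p830066 (lead G1) fed by the growth hypothesis.
THE GLUE used here (all ★): Peter–Weyl blocks ★ `exists_irreducible_orthogonal_blocks` + the block criterion ★ `exists_hilbertBasis_summable_norm_apply_of_irreducible_blocks`
(p829263), the Casimir block bound ★ `norm_apply_le_of_kBlock` (p829889), smoothness of the blocks ★ `toSubmodule_le_harishChandraSpace_of_finiteDimensional_homRangeSum`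
(G2) and their algebraic irreducibility ★ `ClosedSubrep.eq_bot_or_eq_of_le_of_isTopIrreducible` (G3).

* `archIntegratedOperatorNuclearOfKTypeGrowth_of_pieces` — `hfam → hsum → ArchIntegratedOperatorNuclearOfKTypeGrowth L ι H T hT νinf`.

HONEST LABEL: a composition; H3b and H4 are NOT proved here; V22 and A5 (#91) stay booked until they land.  HC_CM is proved only modulo the 2 remaining named inputs
(hLiu418, h413) until rung 0 closes.

## References
* V. S. Varadarajan, *An Introduction to Harmonic Analysis on Semisimple Lie Groups* (1989), §5.4 Lemma 21, Thm. 22 (PDF pp. 159–161) [Varadarajan1989].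
* A. W. Knapp, *Representation Theory of Semisimple Groups: An Overview Based on Examples* (1986), Thm. 10.2, (10.4)–(10.6) [Knapp1986].
-/

set_option autoImplicit false

noncomputable section

open NumberField MeasureTheory CompactlySupported
open Literature.Analysis.OperatorTheory
-- `Classical`: the place subtypes indexing `mixedSpace L` are `Fintype` classically, as in ★ `UnitaryGroupArchCharacterTraceClass` (token-for-token binder match).
open scoped Matrix InnerProductSpace ENNReal NNReal Classical

namespace Literature.NumberTheory.Automorphic.UnitaryGroup

open Literature.RepresentationTheory.KonnoKonno2007 Literature.RepresentationTheory.KonnoKonno2007.RealDualPair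

variable (L : Type) [Field L] [NumberField L] [IsCMField L] (ι : L →+* ℂ) (H : Matrix (Fin 3) (Fin 3) L) (T : GL (Fin 3) ℂ)
  (hT : (T : Matrix (Fin 3) (Fin 3) ℂ)ᴴ * H.map ι * (T : Matrix (Fin 3) (Fin 3) ℂ) = Literature.Geometry.ComplexHyperbolic.BallModel.J)

/-- **V22 [Varadarajan1989 Thm. 22] FROM ITS TWO PAYABLE PIECES**: the Casimir operator family `hfam` (H3b: `T 0 = Op_φ`, `T j (v + Ω_K v) = T (j+1) v` on `H_K^∞`) and
the block Casimir-weight summability `hsum` (H4: `Σ_{W ∈ S} dim W · (1+q_W)^{-n} < ∞` over pairwise orthogonal irreducible finite-dimensional smooth `K`-blocks, under the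
growth hypothesis) give ★ `ArchIntegratedOperatorNuclearOfKTypeGrowth L ι H T hT νinf`: along the Hilbert basis adapted to the Peter–Weyl block decomposition of `ϖ|_K`,
`Σ_k ‖Op_φ e_k‖ ≤ ‖T n‖ · Σ_W dim W · (1+q_W)^{-n} < ∞` by the Casimir block bound ★ `norm_apply_le_of_kBlock`.
[cite: Varadarajan1989, §5.4 Thm. 22, proof pp. 160–161] [cite: Knapp1986, Thm. 10.2] -/
theorem archIntegratedOperatorNuclearOfKTypeGrowth_of_pieces
    (νinf : @Measure (arch (↥(maximalRealSubfield L)) L (IsCMField.complexConj L) 3 H) (borel _))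
    (hfam : letI : MeasurableSpace (arch (↥(maximalRealSubfield L)) L (IsCMField.complexConj L) 3 H) := borel _
      haveI : BorelSpace (arch (↥(maximalRealSubfield L)) L (IsCMField.complexConj L) 3 H) := ⟨rfl⟩
      ∀ (_hν : νinf.IsHaarMeasure)
        (E : Type) [NormedAddCommGroup E] [InnerProductSpace ℂ E] [CompleteSpace E]
        (ϖ : ContRepresentation ℂ (uFormGroup (Fin 2) (Fin 1)).carrier E) (hu : ϖ.IsUnitary) (hc : ϖ.IsStronglyContinuous)
        (φ : arch (↥(maximalRealSubfield L)) L (IsCMField.complexConj L) 3 H → ℂ) (hφc : Continuous φ) (hφs : HasCompactSupport φ),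
        (∃ φ' : GL (Fin 3) (NumberField.mixedEmbedding.mixedSpace L) → ℂ, Continuous φ' ∧ HasCompactSupport φ' ∧
            IsArchSmooth (archGroupGL 3 L).carrier.subtype φ' ∧
            ∀ k : arch (↥(maximalRealSubfield L)) L (IsCMField.complexConj L) 3 H,
              φ k = φ' (k : GL (Fin 3) (NumberField.mixedEmbedding.mixedSpace L))) →
        ∀ n : ℕ, ∃ Tf : ℕ → (E →L[ℂ] E),
          Tf 0 = (ϖ.restrict (archProjUForm L ι H T hT)).integratedOperator (hu.restrict _)
            (hc.restrict _ (continuous_archProjUForm L ι H T hT)) νinf ⟨⟨φ, hφc⟩, hφs⟩ ∧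
          ∀ j < n, ∀ v ∈ harishChandraSpace (uFormGroup (Fin 2) (Fin 1)) ϖ, Tf j (v + upqKCasimirVec ϖ v) = Tf (j + 1) v)
    (hsum : ∀ (E : Type) [NormedAddCommGroup E] [InnerProductSpace ℂ E] [CompleteSpace E]
        (ϖ : ContRepresentation ℂ (uFormGroup (Fin 2) (Fin 1)).carrier E) (_hu : ϖ.IsUnitary) (_hc : ϖ.IsStronglyContinuous),
        (∃ (c : ℝ) (r : ℕ), ∀ (W : Type) [AddCommGroup W] [Module ℂ W] [FiniteDimensional ℂ W]
            (τ : Representation ℂ (uFormGroup (Fin 2) (Fin 1)).maximalCompact W), τ.IsIrreducible →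
            FiniteDimensional ℂ (Representation.homRangeSum
                (ϖ.restrict (Subgroup.inclusion (uFormGroup (Fin 2) (Fin 1)).maximalCompact_le_carrier)).toRepresentation τ) ∧
              (Module.finrank ℂ (Representation.homRangeSum
                  (ϖ.restrict (Subgroup.inclusion (uFormGroup (Fin 2) (Fin 1)).maximalCompact_le_carrier)).toRepresentation τ) : ℝ) ≤
                c * (Module.finrank ℂ W : ℝ) ^ r) →
        ∀ S : Set (ContRepresentation.ClosedSubrep (ϖ.restrict (Subgroup.inclusion (uFormGroup (Fin 2) (Fin 1)).maximalCompact_le_carrier))),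
          S.Pairwise (fun W W' => W.toSubmodule ⟂ W'.toSubmodule) →
          (∀ W ∈ S, W.toContRep.IsTopIrreducible) → (∀ W ∈ S, FiniteDimensional ℂ W.toSubmodule) →
          (∀ W ∈ S, W.toSubmodule ≤ harishChandraSpace (uFormGroup (Fin 2) (Fin 1)) ϖ) →
          ∃ n : ℕ, Summable fun W : S =>
            (Module.finrank ℂ (W : ContRepresentation.ClosedSubrep
              (ϖ.restrict (Subgroup.inclusion (uFormGroup (Fin 2) (Fin 1)).maximalCompact_le_carrier))).toSubmodule : ℝ) *
              ((1 + upqKBlockScalar ϖ (W : ContRepresentation.ClosedSubrep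
                (ϖ.restrict (Subgroup.inclusion (uFormGroup (Fin 2) (Fin 1)).maximalCompact_le_carrier))).toSubmodule) ^ n)⁻¹) :
    ArchIntegratedOperatorNuclearOfKTypeGrowth L ι H T hT νinf := by
  intro hν E _ _ _ ϖ hu hc hgrowth φ hφc hφs hφ'
  -- `ϖ|_K` is a unitary strongly continuous representation of the compact group `K`
  haveI : CompactSpace (uFormGroup (Fin 2) (Fin 1)).maximalCompact := (uFormGroup (Fin 2) (Fin 1)).compactSpace_maximalCompact
  have hincl : Continuous (Subgroup.inclusion (uFormGroup (Fin 2) (Fin 1)).maximalCompact_le_carrier) :=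
    continuous_induced_rng.2 continuous_subtype_val
  have hcK : (ϖ.restrict (Subgroup.inclusion (uFormGroup (Fin 2) (Fin 1)).maximalCompact_le_carrier)).IsStronglyContinuous :=
    hc.restrict _ hincl
  have huK : (ϖ.restrict (Subgroup.inclusion (uFormGroup (Fin 2) (Fin 1)).maximalCompact_le_carrier)).IsUnitary := hu.restrict _
  -- Peter–Weyl: irreducible finite-dimensional pairwise orthogonal blocks with dense sum
  obtain ⟨S, hirr, hfd, horth, hdense⟩ := exists_irreducible_orthogonal_blocks hcK huK
  have horth' : S.Pairwise (fun W W' => W.toSubmodule ⟂ W'.toSubmodule) :=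
    (pairwise_subtype_iff_pairwise_set S fun W W' => W.toSubmodule ⟂ W'.toSubmodule).1 horth.pairwise
  -- the growth hypothesis makes every block smooth
  obtain ⟨c, r, hgr⟩ := hgrowth
  have hsmooth : ∀ W ∈ S, W.toSubmodule ≤ harishChandraSpace (uFormGroup (Fin 2) (Fin 1)) ϖ := by
    intro W hW
    haveI := hfd W hW
    have hirrW : W.toContRep.toRepresentation.IsIrreducible := isIrreducible_of_isTopIrreducible_block W.toContRep (hirr W hW)
    haveI := (hgr W.toSubmodule W.toContRep.toRepresentation hirrW).1
    exact (uFormGroup (Fin 2) (Fin 1)).toSubmodule_le_harishChandraSpace_of_finiteDimensional_homRangeSum hu hc W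
  -- the block Casimir-weight summability (H4) and the operator family (H3b)
  obtain ⟨n, hsn⟩ := hsum E ϖ hu hc ⟨c, r, hgr⟩ S horth' hirr hfd hsmooth
  obtain ⟨Tf, hTf0, hTf⟩ := hfam hν E ϖ hu hc φ hφc hφs hφ' n
  -- block bounds `c_W = (1+q_W)^{-n} ‖T n‖` on each block, by the Casimir block bound
  have hcW : ∀ W : S, ∀ v ∈ (W : ContRepresentation.ClosedSubrep
      (ϖ.restrict (Subgroup.inclusion (uFormGroup (Fin 2) (Fin 1)).maximalCompact_le_carrier))).toSubmodule,
      ‖Tf 0 v‖ ≤ ((1 + upqKBlockScalar ϖ (W : ContRepresentation.ClosedSubrep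
        (ϖ.restrict (Subgroup.inclusion (uFormGroup (Fin 2) (Fin 1)).maximalCompact_le_carrier))).toSubmodule) ^ n)⁻¹ * ‖Tf n‖ * ‖v‖ := by
    rintro ⟨W, hW⟩ v hv
    haveI := hfd W hW
    have hWs : W.toSubmodule ≤ smoothVectors (uFormGroup (Fin 2) (Fin 1)) ϖ := (hsmooth W hW).trans inf_le_left
    have hWK : ∀ (k : (uFormGroup (Fin 2) (Fin 1)).maximalCompact) (w : E), w ∈ W.toSubmodule →
        ϖ (Subgroup.inclusion (uFormGroup (Fin 2) (Fin 1)).maximalCompact_le_carrier k) w ∈ W.toSubmodule :=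
      fun k w hw => W.apply_mem k hw
    have hWirr : ∀ W' : Submodule ℂ E, W' ≤ W.toSubmodule →
        (∀ (k : (uFormGroup (Fin 2) (Fin 1)).maximalCompact) (w : E), w ∈ W' →
          ϖ (Subgroup.inclusion (uFormGroup (Fin 2) (Fin 1)).maximalCompact_le_carrier k) w ∈ W') →
        W' = ⊥ ∨ W' = W.toSubmodule := fun W' hle hst =>
      ClosedSubrep.eq_bot_or_eq_of_le_of_isTopIrreducible W (hirr W hW) W' hle hst
    have h := norm_apply_le_of_kBlock ϖ W.toSubmodule hu hc hWs hWK hWirr n Tf hTf hv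
    calc ‖Tf 0 v‖ ≤ ((1 + upqKBlockScalar ϖ W.toSubmodule) ^ n)⁻¹ * (‖Tf n‖ * ‖v‖) := h
      _ = ((1 + upqKBlockScalar ϖ W.toSubmodule) ^ n)⁻¹ * ‖Tf n‖ * ‖v‖ := by ring
  have hsum' : Summable fun W : S =>
      (Module.finrank ℂ (W : ContRepresentation.ClosedSubrep
        (ϖ.restrict (Subgroup.inclusion (uFormGroup (Fin 2) (Fin 1)).maximalCompact_le_carrier))).toSubmodule : ℝ) *
      (((1 + upqKBlockScalar ϖ (W : ContRepresentation.ClosedSubrep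
        (ϖ.restrict (Subgroup.inclusion (uFormGroup (Fin 2) (Fin 1)).maximalCompact_le_carrier))).toSubmodule) ^ n)⁻¹ * ‖Tf n‖) := by
    refine (hsn.mul_right ‖Tf n‖).congr fun W => ?_
    ring
  obtain ⟨B, -, hB, -⟩ := exists_hilbertBasis_summable_norm_apply_of_irreducible_blocks hfd horth hdense (Tf 0) _ hcW hsum'
  rw [hTf0] at hB
  exact ⟨_, B, hB⟩

end Literature.NumberTheory.Automorphic.UnitaryGroup

end
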